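import Mathlib
import Summits.NavierStokesRegularity.OSWSelfSimilar.SheetRowThirdHilbert
import HarnessLib

/-!
# Faithfulness check of the first-moment identity (M) on the kernel exact row `c_l = 1/3`:
# with the GENUINE Hilbert transform and velocity, (M) holds on the dilated double-pole ansatz IFF the amplitude law `aA = 8/3`

HONEST FRAMING (cell ns-blowup GROUP B «PROFILE SEARCH», zone Z3 = the 1-D viscous gCLM/OSW sheet; human rulings
D-0035/D-0074): **1-D MODEL; closed-form calculus kernel-checked; not Euler, not Navier–Stokes; «violates: none — MODEL».**

PURPOSE (non-vacuity / sign-convention test of `SheetMomentIdentity`, the analogue of `SheetHalfLineThirdRowCheck` for (★)):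
re-derive, in the kernel and with the genuine `hilbertTransform` and the genuine velocity `𝒰` (`𝒰′ = HΩ`, `𝒰(0) = 0`) of the
exact row `c_l = 1/3` of SHEET-ℝ (`SheetRowThirdExactFamily` / `SheetRowThirdHilbert`: `Ω(η) = −A f(η/ℓ)`, `f(x) = x/(1+x²)²`,
`HΩ(ξ) = −A (Hf)(ξ/ℓ)`, `Hf = (x²−1)/(2(1+x²)²)`, `𝒰(η) = −Aℓ·𝒰_f(η/ℓ)`, `𝒰_f = primProfile = −x/(2(1+x²))`), the three terms
of the first-moment identity (M) of `SheetHalfLine.moment_identity` at `(c_ω, c_l, b, P) = (1, 1/3, 1, 0)`,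
  `(c_ω − 2c_l)∫₀^∞ ξΩ − a∫₀^∞ 𝒰Ω − (1 + a)∫₀^∞ ξ(HΩ)Ω = 0`,                                              (M)
and confirm that on the ansatz with FREE amplitude `A` (any width `ℓ > 0`, any `ε`) (M) is EQUIVALENT to the AMPLITUDE LAW
`aA = 8/3` of the exact row (`SheetRowThirdExactFamily.width_relation`'s hypothesis `a·A = 8/3`; SHEET §8 «cw = 8/(3a)») — just as
(★) was equivalent to the WIDTH law `ℓ²(1−2a) = 9εa` (`SheetHalfLine.halfLine_thirdRow_iff_width`). In particular the SIGN of the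
velocity–vorticity term `−a∫₀^∞𝒰Ω` of (M) — the term that empties the E-signed NS-type line for `a < 0`
(`SheetHalfLine.nsTypeLine_ESigned_empty_of_a_neg`) — is tested against an exact sheet point with outward velocity (`𝒰 > 0` on
`(0,∞)` for `A > 0`).

* `integral_Ioi_id_mul_profile` — `∫₀^∞ x²/(1+x²)² dx = π/4` (primitive `(arctan x − x/(1+x²))/2`);
* `integral_Ioi_primProfile_mul_profile` — `∫₀^∞ 𝒰_f·f = −π/32` (primitive `−(arctan x + x/(1+x²) − 2x/(1+x²)²)/16`);
* `integral_Ioi_id_mul_hilbProfile_mul_profile` — **`∫₀^∞ x (Hf) f = 0`** (primitive `−x³/(6(1+x²)³)`): the MOMENT NULL of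
  `SheetHalfLineMomentNull` in closed form on the double pole;
* dilated values `−Aℓ²π/4`, `−A²ℓ²π/32`, `0` and
* `moment_thirdRow_iff_amplitude` — **(M) on the ansatz ⇔ `aA = 8/3`** (the left side equals `(Aℓ²π/96)·(3aA − 8)`).
No definitions, no hypotheses of `Prop` type. bears_on: LADDER-NS N5 / Z3 clause (i′) → N1 linear core. WHAT THIS IS NOT: not NS;
not a new sheet point.
-/

noncomputable section
open Set Filter Topology MeasureTheory
open scoped Real

namespace Summit.NavierStokesRegularity.OSWSelfSimilar
namespace SheetHalfLine
open SheetRowThirdExactFamily Literature.Analysis.Fourier Real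

/-! ### Three closed-form half-line integrals of the double-pole profile -/

/-- `(1 + x²) → +∞`. [folklore] -/
private theorem mt_tendsto_one_add_sq : Tendsto (fun y : ℝ => 1 + y ^ 2) atTop atTop :=
  tendsto_atTop_add_const_left _ _ (tendsto_pow_atTop two_ne_zero)

/-- `x/(1+x²) → 0` at `+∞`. [folklore] -/
private theorem mt_tendsto_div_one_add_sq : Tendsto (fun x : ℝ => x / (1 + x ^ 2)) atTop (𝓝 0) := by
  have h1 : Tendsto (fun x : ℝ => x⁻¹) atTop (𝓝 0) := tendsto_inv_atTop_zero
  have e : ∀ᶠ x : ℝ in atTop, x / (1 + x ^ 2) ≤ x⁻¹ := by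
    filter_upwards [eventually_gt_atTop (0:ℝ)] with x hx
    rw [div_le_iff₀ (by positivity), inv_mul_eq_div, le_div_iff₀ hx]
    nlinarith
  have e0 : ∀ᶠ x : ℝ in atTop, 0 ≤ x / (1 + x ^ 2) := by
    filter_upwards [eventually_ge_atTop (0:ℝ)] with x hx
    positivity
  exact tendsto_of_tendsto_of_tendsto_of_le_of_le' tendsto_const_nhds h1 e0 e

/-- `x/((1+x²)(1+x²)) → 0` and `x³/((1+x²)(1+x²)(1+x²)) → 0` at `+∞`. [folklore] -/
private theorem mt_tendsto_div_sq : Tendsto (fun x : ℝ => x / ((1 + x ^ 2) * (1 + x ^ 2))) atTop (𝓝 0) := by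
  have h := mt_tendsto_div_one_add_sq
  have h1 : Tendsto (fun x : ℝ => (1 + x ^ 2)⁻¹) atTop (𝓝 0) := tendsto_inv_atTop_zero.comp mt_tendsto_one_add_sq
  have h2 := h.mul h1
  rw [mul_zero] at h2
  refine h2.congr' (Eventually.of_forall fun x => ?_)
  have hx : (1 + x ^ 2) ≠ 0 := by positivity
  field_simp

/-- `x³/((1+x²)(1+x²)(1+x²)) = (x/(1+x²))³ → 0` at `+∞`. [folklore] -/
private theorem mt_tendsto_cube_div : Tendsto (fun x : ℝ => x ^ 3 / ((1 + x ^ 2) * (1 + x ^ 2) * (1 + x ^ 2))) atTop (𝓝 0) := by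
  have h := mt_tendsto_div_one_add_sq.pow 3
  rw [show ((0:ℝ) ^ 3) = 0 by norm_num] at h
  refine h.congr' (Eventually.of_forall fun x => ?_)
  have hx : (1 + x ^ 2) ≠ 0 := by positivity
  rw [div_pow]
  ring

/-- **`∫₀^∞ x·f(x) dx = ∫₀^∞ x²/(1+x²)² dx = π/4`** (primitive `(arctan x − x/(1+x²))/2`). [folklore] -/
theorem integral_Ioi_id_mul_profile : ∫ x in Ioi (0:ℝ), x * profile x = π / 4 := by
  have hd : ∀ x ∈ Ioi (0:ℝ), HasDerivAt (fun y : ℝ => (arctan y - y / (1 + y ^ 2)) / 2) (x * profile x) x := by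
    intro x _
    have hpos : (1 + x ^ 2) ≠ 0 := by positivity
    have h := ((hasDerivAt_arctan x).sub ((hasDerivAt_id' x).div (hasDerivAt_one_add_sq x) hpos)).div_const 2
    refine h.congr_deriv ?_
    unfold profile
    field_simp
    ring
  have hc : ContinuousWithinAt (fun y : ℝ => (arctan y - y / (1 + y ^ 2)) / 2) (Ici 0) 0 :=
    (((hasDerivAt_arctan 0).sub ((hasDerivAt_id' 0).div (hasDerivAt_one_add_sq 0) (by positivity))).div_const
      2).continuousAt.continuousWithinAt
  have hlim : Tendsto (fun y : ℝ => (arctan y - y / (1 + y ^ 2)) / 2) atTop (𝓝 ((π / 2 - 0) / 2)) :=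
    ((tendsto_arctan_atTop.mono_right nhdsWithin_le_nhds).sub mt_tendsto_div_one_add_sq).div_const 2
  have hint : IntegrableOn (fun x => x * profile x) (Ioi (0:ℝ)) := by
    refine (integrable_inv_one_add_sq.mono' ?_ (Eventually.of_forall fun x => ?_)).integrableOn
    · exact (continuous_id.mul (by unfold profile; fun_prop (disch := intro x; positivity))).aestronglyMeasurable
    · unfold profile
      have h1 : 0 < 1 + x ^ 2 := by positivity
      rw [Real.norm_eq_abs, show x * (x / (1 + x ^ 2) ^ 2) = x ^ 2 / (1 + x ^ 2) * (1 + x ^ 2)⁻¹ by field_simp,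
        abs_of_nonneg (by positivity)]
      apply mul_le_of_le_one_left (by positivity)
      rw [div_le_one h1]
      linarith
  rw [integral_Ioi_of_hasDerivAt_of_tendsto hc hd hint hlim, arctan_zero]
  ring

/-- **`∫₀^∞ 𝒰_f·f = ∫₀^∞ (−x/(2(1+x²)))·(x/(1+x²)²) dx = −π/32`** (primitive `−(arctan x + x/(1+x²) − 2x/(1+x²)²)/16`).
[folklore] -/
theorem integral_Ioi_primProfile_mul_profile : ∫ x in Ioi (0:ℝ), primProfile x * profile x = -(π / 32) := by
  have hd : ∀ x ∈ Ioi (0:ℝ), HasDerivAt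
      (fun y : ℝ => -(arctan y + y / (1 + y ^ 2) - 2 * (y / ((1 + y ^ 2) * (1 + y ^ 2)))) / 16)
      (primProfile x * profile x) x := by
    intro x _
    have hpos : (1 + x ^ 2) ≠ 0 := by positivity
    have hpos2 : (1 + x ^ 2) * (1 + x ^ 2) ≠ 0 := by positivity
    have h2 : HasDerivAt (fun y : ℝ => (1 + y ^ 2) * (1 + y ^ 2)) (2 * x * (1 + x ^ 2) + (1 + x ^ 2) * (2 * x)) x :=
      (hasDerivAt_one_add_sq x).mul (hasDerivAt_one_add_sq x)
    have h := (((hasDerivAt_arctan x).add ((hasDerivAt_id' x).div (hasDerivAt_one_add_sq x) hpos)).sub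
      (((hasDerivAt_id' x).div h2 hpos2).const_mul 2)).neg.div_const 16
    refine h.congr_deriv ?_
    unfold primProfile profile
    field_simp
    ring
  have hc : ContinuousWithinAt
      (fun y : ℝ => -(arctan y + y / (1 + y ^ 2) - 2 * (y / ((1 + y ^ 2) * (1 + y ^ 2)))) / 16) (Ici 0) 0 := by
    refine Continuous.continuousWithinAt ?_
    exact (((continuous_arctan.add (continuous_id.div (by fun_prop) fun x => by positivity)).sub
      ((continuous_id.div (by fun_prop) fun x => by positivity).const_mul 2)).neg.div_const 16)
  have hlim : Tendsto (fun y : ℝ => -(arctan y + y / (1 + y ^ 2) - 2 * (y / ((1 + y ^ 2) * (1 + y ^ 2)))) / 16) atTop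
      (𝓝 (-(π / 2 + 0 - 2 * 0) / 16)) :=
    ((((tendsto_arctan_atTop.mono_right nhdsWithin_le_nhds).add mt_tendsto_div_one_add_sq).sub
      (mt_tendsto_div_sq.const_mul 2)).neg).div_const 16
  have hint : IntegrableOn (fun x => primProfile x * profile x) (Ioi (0:ℝ)) := by
    refine (integrable_inv_one_add_sq.mono' ?_ (Eventually.of_forall fun x => ?_)).integrableOn
    · exact (Continuous.mul (by unfold primProfile; fun_prop (disch := intro x; positivity))
        (by unfold profile; fun_prop (disch := intro x; positivity))).aestronglyMeasurable
    · unfold primProfile profile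
      have h1 : 0 < 1 + x ^ 2 := by positivity
      rw [Real.norm_eq_abs, show -x / (2 * (1 + x ^ 2)) * (x / (1 + x ^ 2) ^ 2)
          = -(x ^ 2 / (1 + x ^ 2) * (1 + x ^ 2)⁻¹ * (1 + x ^ 2)⁻¹ / 2) by field_simp, abs_neg,
        abs_of_nonneg (by positivity)]
      have ha : x ^ 2 / (1 + x ^ 2) ≤ 1 := by rw [div_le_one h1]; linarith
      have hb : (1 + x ^ 2)⁻¹ ≤ 1 := inv_le_one_of_one_le₀ (le_add_of_nonneg_right (sq_nonneg x))
      have hc' : 0 ≤ (1 + x ^ 2)⁻¹ := by positivity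
      calc x ^ 2 / (1 + x ^ 2) * (1 + x ^ 2)⁻¹ * (1 + x ^ 2)⁻¹ / 2
          ≤ 1 * (1 + x ^ 2)⁻¹ * 1 / 2 := by gcongr
        _ ≤ (1 + x ^ 2)⁻¹ := by nlinarith
  rw [integral_Ioi_of_hasDerivAt_of_tendsto hc hd hint hlim, arctan_zero]
  ring

/-- **THE MOMENT NULL IN CLOSED FORM ON THE DOUBLE POLE: `∫₀^∞ x·(Hf)(x)·f(x) dx = ∫₀^∞ x²(x²−1)/(2(1+x²)⁴) dx = 0`**
(primitive `−x³/(6(1+x²)³)`, vanishing at `0` and at `+∞`). [folklore] -/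
theorem integral_Ioi_id_mul_hilbProfile_mul_profile : ∫ x in Ioi (0:ℝ), x * (hilbProfile x * profile x) = 0 := by
  have hd : ∀ x ∈ Ioi (0:ℝ), HasDerivAt (fun y : ℝ => -(y ^ 3 / ((1 + y ^ 2) * (1 + y ^ 2) * (1 + y ^ 2))) / 6)
      (x * (hilbProfile x * profile x)) x := by
    intro x _
    have hpos3 : (1 + x ^ 2) * (1 + x ^ 2) * (1 + x ^ 2) ≠ 0 := by positivity
    have h3 : HasDerivAt (fun y : ℝ => (1 + y ^ 2) * (1 + y ^ 2) * (1 + y ^ 2))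
        ((2 * x * (1 + x ^ 2) + (1 + x ^ 2) * (2 * x)) * (1 + x ^ 2) + (1 + x ^ 2) * (1 + x ^ 2) * (2 * x)) x :=
      ((hasDerivAt_one_add_sq x).mul (hasDerivAt_one_add_sq x)).mul (hasDerivAt_one_add_sq x)
    have hp : HasDerivAt (fun y : ℝ => y ^ 3) (3 * x ^ 2) x := by
      simpa using hasDerivAt_pow 3 x
    have h := ((hp.div h3 hpos3).neg).div_const 6
    refine h.congr_deriv ?_
    unfold hilbProfile profile
    field_simp
    ring
  have hc : ContinuousWithinAt (fun y : ℝ => -(y ^ 3 / ((1 + y ^ 2) * (1 + y ^ 2) * (1 + y ^ 2))) / 6) (Ici 0) 0 := by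
    refine Continuous.continuousWithinAt ?_
    exact ((Continuous.div (by fun_prop) (by fun_prop) fun x => by positivity).neg).div_const 6
  have hlim : Tendsto (fun y : ℝ => -(y ^ 3 / ((1 + y ^ 2) * (1 + y ^ 2) * (1 + y ^ 2))) / 6) atTop (𝓝 (-0 / 6)) :=
    (mt_tendsto_cube_div.neg).div_const 6
  have hint : IntegrableOn (fun x => x * (hilbProfile x * profile x)) (Ioi (0:ℝ)) := by
    refine (integrable_inv_one_add_sq.mono' ?_ (Eventually.of_forall fun x => ?_)).integrableOn
    · exact (continuous_id.mul (Continuous.mul (by unfold hilbProfile; fun_prop (disch := intro x; positivity))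
        (by unfold profile; fun_prop (disch := intro x; positivity)))).aestronglyMeasurable
    · unfold hilbProfile profile
      have h1 : 0 < 1 + x ^ 2 := by positivity
      rw [Real.norm_eq_abs, show x * ((x ^ 2 - 1) / (2 * (1 + x ^ 2) ^ 2) * (x / (1 + x ^ 2) ^ 2))
          = (x ^ 2 / (1 + x ^ 2)) * ((x ^ 2 - 1) / (1 + x ^ 2)) * (1 + x ^ 2)⁻¹ * (1 + x ^ 2)⁻¹ / 2 by field_simp]
      have ha : |x ^ 2 / (1 + x ^ 2)| ≤ 1 := by
        rw [abs_of_nonneg (by positivity), div_le_one h1]; linarith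
      have hb : |(x ^ 2 - 1) / (1 + x ^ 2)| ≤ 1 := by
        rw [abs_div, abs_of_pos h1, div_le_one h1]
        exact abs_le.mpr ⟨by nlinarith, by linarith⟩
      have hone : 1 ≤ 1 + x ^ 2 := le_add_of_nonneg_right (sq_nonneg x)
      have hpos : 0 ≤ (1 + x ^ 2)⁻¹ := by positivity
      rw [abs_div, abs_mul, abs_mul, abs_mul, abs_of_nonneg hpos, abs_two]
      calc |x ^ 2 / (1 + x ^ 2)| * |(x ^ 2 - 1) / (1 + x ^ 2)| * (1 + x ^ 2)⁻¹ * (1 + x ^ 2)⁻¹ / 2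
          ≤ 1 * 1 * (1 + x ^ 2)⁻¹ * 1 / 2 := by gcongr; exact inv_le_one_of_one_le₀ hone
        _ ≤ (1 + x ^ 2)⁻¹ := by nlinarith
  rw [integral_Ioi_of_hasDerivAt_of_tendsto hc hd hint hlim]
  simp

/-! ### The dilated family `Ω(η) = −A f(η/ℓ)`, `𝒰(η) = −Aℓ 𝒰_f(η/ℓ)` -/

/-- `∫₀^∞ η·(−A f(η/ℓ)) dη = −Aℓ²·π/4` for `ℓ > 0`. [folklore] -/
theorem integral_Ioi_id_mul_dilatedProfile (A : ℝ) {ℓ : ℝ} (hℓ : 0 < ℓ) :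
    ∫ η in Ioi (0:ℝ), η * (-A * profile (η / ℓ)) = -(A * ℓ ^ 2) * (π / 4) := by
  have h := integral_comp_mul_left_Ioi (fun x => (ℓ * x) * (-A * profile x)) 0 (inv_pos.mpr hℓ)
  simp only [mul_zero, inv_inv, smul_eq_mul] at h
  have e : ∫ η in Ioi (0:ℝ), η * (-A * profile (η / ℓ)) = ∫ x in Ioi (0:ℝ), (ℓ * (ℓ⁻¹ * x)) * (-A * profile (ℓ⁻¹ * x)) :=
    setIntegral_congr_fun measurableSet_Ioi fun x _ => by
      have hx : ℓ * (ℓ⁻¹ * x) = x := by field_simp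
      rw [hx, div_eq_inv_mul]
  have e2 : ∫ x in Ioi (0:ℝ), (ℓ * x) * (-A * profile x) = -(A * ℓ) * ∫ x in Ioi (0:ℝ), x * profile x := by
    rw [← integral_const_mul]
    refine setIntegral_congr_fun measurableSet_Ioi fun x _ => ?_
    ring
  rw [e, h, e2, integral_Ioi_id_mul_profile]
  ring

/-- `∫₀^∞ (−Aℓ 𝒰_f(η/ℓ))·(−A f(η/ℓ)) dη = −A²ℓ²·π/32` for `ℓ > 0`. [folklore] -/
theorem integral_Ioi_dilatedVelocityPairing (A : ℝ) {ℓ : ℝ} (hℓ : 0 < ℓ) :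
    ∫ η in Ioi (0:ℝ), (-A * ℓ * primProfile (η / ℓ)) * (-A * profile (η / ℓ)) = -(A ^ 2 * ℓ ^ 2) * (π / 32) := by
  have h := integral_comp_mul_left_Ioi (fun x => (-A * ℓ * primProfile x) * (-A * profile x)) 0 (inv_pos.mpr hℓ)
  simp only [mul_zero, inv_inv, smul_eq_mul] at h
  have e : ∫ η in Ioi (0:ℝ), (-A * ℓ * primProfile (η / ℓ)) * (-A * profile (η / ℓ))
      = ∫ x in Ioi (0:ℝ), (-A * ℓ * primProfile (ℓ⁻¹ * x)) * (-A * profile (ℓ⁻¹ * x)) :=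
    setIntegral_congr_fun measurableSet_Ioi fun x _ => by rw [div_eq_inv_mul]
  have e2 : ∫ x in Ioi (0:ℝ), (-A * ℓ * primProfile x) * (-A * profile x)
      = A ^ 2 * ℓ * ∫ x in Ioi (0:ℝ), primProfile x * profile x := by
    rw [← integral_const_mul]
    refine setIntegral_congr_fun measurableSet_Ioi fun x _ => ?_
    ring
  rw [e, h, e2, integral_Ioi_primProfile_mul_profile]
  ring

/-- `∫₀^∞ η·(HΩ)(η)·Ω(η) dη = 0` for `Ω(η) = −A f(η/ℓ)` with its GENUINE Hilbert transform (`ℓ > 0`): the moment null, closed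
form. [folklore] -/
theorem integral_Ioi_id_mul_dilatedPairing (A : ℝ) {ℓ : ℝ} (hℓ : 0 < ℓ) :
    ∫ η in Ioi (0:ℝ), η * (hilbertTransform (fun η => -A * profile (η / ℓ)) η * (-A * profile (η / ℓ))) = 0 := by
  have hH : ∫ η in Ioi (0:ℝ), η * (hilbertTransform (fun η => -A * profile (η / ℓ)) η * (-A * profile (η / ℓ)))
      = ∫ η in Ioi (0:ℝ), η * ((-A * hilbProfile (η / ℓ)) * (-A * profile (η / ℓ))) :=
    setIntegral_congr_fun measurableSet_Ioi fun η _ => by rw [hilbertTransform_dilatedProfile _ hℓ η]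
  have h := integral_comp_mul_left_Ioi (fun x => (ℓ * x) * ((-A * hilbProfile x) * (-A * profile x))) 0 (inv_pos.mpr hℓ)
  simp only [mul_zero, inv_inv, smul_eq_mul] at h
  have e : ∫ η in Ioi (0:ℝ), η * ((-A * hilbProfile (η / ℓ)) * (-A * profile (η / ℓ)))
      = ∫ x in Ioi (0:ℝ), (ℓ * (ℓ⁻¹ * x)) * ((-A * hilbProfile (ℓ⁻¹ * x)) * (-A * profile (ℓ⁻¹ * x))) :=
    setIntegral_congr_fun measurableSet_Ioi fun x _ => by
      have hx : ℓ * (ℓ⁻¹ * x) = x := by field_simp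
      rw [hx, div_eq_inv_mul]
  have e2 : ∫ x in Ioi (0:ℝ), (ℓ * x) * ((-A * hilbProfile x) * (-A * profile x))
      = A ^ 2 * ℓ * ∫ x in Ioi (0:ℝ), x * (hilbProfile x * profile x) := by
    rw [← integral_const_mul]
    refine setIntegral_congr_fun measurableSet_Ioi fun x _ => ?_
    ring
  rw [hH, e, h, e2, integral_Ioi_id_mul_hilbProfile_mul_profile]
  ring

/-! ### (M) on the exact row ⇔ the amplitude law -/

/-- **FAITHFULNESS OF (M) ON THE KERNEL ROW `c_l = 1/3`.** For `A ≠ 0`, `ℓ > 0`, any `a`, and the dilated double-pole ansatz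
`Ω(η) = −A f(η/ℓ)` with its GENUINE Hilbert transform (`hilbertTransform_dilatedProfile`) and velocity `𝒰(η) = −Aℓ 𝒰_f(η/ℓ)`
(`hasDerivAt_dilatedPrim`: `𝒰′ = HΩ`, `𝒰(0) = 0`), the left-hand side of the first-moment identity at `(c_ω, c_l) = (1, 1/3)`,
`(1 − 2/3)∫₀^∞ ηΩ − a∫₀^∞ 𝒰Ω − (1 + a)∫₀^∞ η(HΩ)Ω`,
equals `(Aℓ²π/96)·(3aA − 8)`; hence it VANISHES IFF the amplitude law `aA = 8/3` of the exact row holds (SHEET §8 «cw = 8/(3a)»,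
`SheetRowThirdExactFamily.width_relation`) — (M) alone detects the exact row's amplitude, as (★) detected its width.
[new here — MODEL] -/
theorem moment_thirdRow_iff_amplitude {a A ℓ : ℝ} (hA : A ≠ 0) (hℓ : 0 < ℓ) :
    (1 - 2 * (1 / 3)) * (∫ η in Ioi (0:ℝ), η * (-A * profile (η / ℓ)))
        - a * (∫ η in Ioi (0:ℝ), (-A * ℓ * primProfile (η / ℓ)) * (-A * profile (η / ℓ)))
        - (1 + a) * (∫ η in Ioi (0:ℝ), η * (hilbertTransform (fun η => -A * profile (η / ℓ)) η * (-A * profile (η / ℓ))))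
        = 0
      ↔ a * A = 8 / 3 := by
  rw [integral_Ioi_id_mul_dilatedProfile _ hℓ, integral_Ioi_dilatedVelocityPairing _ hℓ,
    integral_Ioi_id_mul_dilatedPairing _ hℓ]
  have key : (1 - 2 * (1 / 3)) * (-(A * ℓ ^ 2) * (π / 4)) - a * (-(A ^ 2 * ℓ ^ 2) * (π / 32)) - (1 + a) * 0
      = (A * ℓ ^ 2 * π / 96) * (3 * (a * A) - 8) := by ring
  rw [key]
  have hcoef : A * ℓ ^ 2 * π / 96 ≠ 0 :=
    div_ne_zero (mul_ne_zero (mul_ne_zero hA (pow_ne_zero 2 hℓ.ne')) Real.pi_ne_zero) (by norm_num)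
  constructor
  · intro h
    rcases mul_eq_zero.mp h with h1 | h1
    · exact absurd h1 hcoef
    · linarith
  · intro h
    rw [h]
    norm_num

/-- The same statement with the amplitude law as HYPOTHESIS: on the kernel row (`aA = 8/3`, any width `ℓ > 0`) the three terms
of (M) computed in closed form with the genuine Hilbert transform and velocity sum to zero:
`−Aℓ²π/12 + aA²ℓ²π/32 − 0 = 0`. [new here — MODEL] -/
theorem moment_thirdRow_check {a A ℓ : ℝ} (hA : A ≠ 0) (hℓ : 0 < ℓ) (hamp : a * A = 8 / 3) :
    (1 - 2 * (1 / 3)) * (∫ η in Ioi (0:ℝ), η * (-A * profile (η / ℓ)))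
        - a * (∫ η in Ioi (0:ℝ), (-A * ℓ * primProfile (η / ℓ)) * (-A * profile (η / ℓ)))
        - (1 + a) * (∫ η in Ioi (0:ℝ), η * (hilbertTransform (fun η => -A * profile (η / ℓ)) η * (-A * profile (η / ℓ))))
        = 0 :=
  (moment_thirdRow_iff_amplitude hA hℓ).mpr hamp

end SheetHalfLine
end Summit.NavierStokesRegularity.OSWSelfSimilar
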